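import Literature.AlgebraicGeometry.Motives.JacobianExistenceSplit
import Literature.AlgebraicGeometry.Motives.GaloisDescentAbelianVariety
import HarnessLib

/-!
# Galois descent of the Jacobian: the Galois action on an abstract Jacobian of `C_L`

Topic `Literature/AlgebraicGeometry/Motives`, sequel of `JacobianGaloisDescent` (which descends a
Jacobian of `C_L` GIVEN an abelian variety `J / k`, an identification `J(C_L) ≅ J_L` and the Galois
equivariance of the resulting `F_L`) and `GaloisDescentAbelianVariety` (descent of an abelian variety
over a finite Galois `L / k` carrying a semilinear Galois action compatible with the group law).
PROOF FILE: theorems and private constructions with bodies — no named fact, sorry-free (D-0026).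

This file supplies what `JacobianExistenceSplit` calls the residual content of the named fact
`Literature.AlgebraicGeometry.Motives.jacobian_galoisDescent` (Milne, *Jacobian Varieties*, Remark 1.9
with §6, proof of Prop. 6.4: "the uniqueness implies that `σψ = ψ` for all `σ` in `Gal(k'/k)`, and so
`ψ` is defined over `k`"): **the semilinear action of `Gal(L/k)` on an ABSTRACT Jacobian `(J', F')` of
`C_L`, constructed from its universal property, and its cocycle condition.** For `σ ∈ Gal(L/k)` the
map `F' ∘ (σ × σ) : (C × C)_L → J'` is an `L`-morphism into the CONJUGATE abelian variety
`J'^{σ} = J' ×_{Spec L, Spec σ⁻¹} Spec L` (the twist functor `AbelianVariety.twist` of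
`AbelianVarietyEndGaloisDescent`, monoidal, so `J'^σ` is an abelian variety), trivial on the diagonal;
the universal property gives a homomorphism `u_σ : J' → J'^σ`, i.e. a `σ`-semilinear automorphism
`ρ σ = u_σ ≫ pr₁` of the scheme `J'` with `F' ∘ (σ × σ) = ρ σ ∘ F'`; uniqueness gives `ρ 1 = 1` and
`ρ (στ) = ρ τ ≫ ρ σ` (a unit-preserving morphism of abelian varieties being a homomorphism,
`AbelianVariety.homOfOneComp`, Milne AV Cor. 2.2), and `u_σ` being a homomorphism gives the
compatibility of `ρ σ` with `μ`, `η`, `ι`. Then `GaloisDescentAbelianVariety.exists_iso_baseChange`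
descends `J'` to `J / k` with `J' ≅ J_L` carrying `ρ σ` to `1 × Spec σ⁻¹`, and
`Jacobian.nonempty_of_galoisDescent` descends `F'`.

Results:
* `Jacobian.nonempty_of_jacobian_baseChange` — **a smooth projective geometrically irreducible
  `C / k` (any dimension) has a Jacobian over `k` as soon as `C_L` has one for some finite Galois
  `L / k`.**
* **`jacobian_galoisDescent_holds : jacobian_galoisDescent`** — the named fact of
  `JacobianExistenceSplit`, now a theorem; hence `nonempty_jacobian_of_isSmoothProjective` follows from
  the pointed case `nonempty_jacobian_of_algPoints` alone
  (`nonempty_jacobian_of_isSmoothProjective_of_algPoints_fact`).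

Relies on: nothing unproved (axioms `propext`, `Classical.choice`, `Quot.sound`).

## References

* [Milne1986JacobianVarieties] J. S. Milne, *Jacobian Varieties*, in Cornell–Silverman, *Arithmetic
  Geometry* (1986): Remark 1.9, §6 Prop. 6.4 (proof, first paragraph) and Remark 6.5.
* [Milne1986AbelianVarieties] J. S. Milne, *Abelian Varieties*, ibid., §2 Cor. 2.2 (rigidity).
* [GortzWedhorn2020] U. Görtz, T. Wedhorn, *Algebraic Geometry I*, 2nd ed. (2020), §(14.20),
  Thm. 14.83, Cor. 14.85 (Galois descent).
-/

noncomputable section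

open CategoryTheory CategoryTheory.Limits AlgebraicGeometry MonoidalCategory CartesianMonoidalCategory

universe u

namespace Literature.AlgebraicGeometry.Motives

namespace Jacobian

open AbelianVariety (bcSpec bcFunctor specAut specAut_mul specAut_one specAut_comp_bcSpec twist)
open scoped MonObj Obj

set_option backward.isDefEq.respectTransparency false

/-! ### The conjugate abelian variety `A^τ` and semilinear homomorphisms `A → A^τ` -/

section Twist

variable {K : Type u} [Field K] (L : Type u) [Field L] [Algebra K L] (τ : L ≃ₐ[K] L)

/-- `(f^τ) ≫ pr₁ = pr₁ ≫ f` for the twist `f^τ = f ×_{Spec L, Spec τ} Spec L` of an `L`-morphism.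
[folklore] -/
@[reassoc]
private theorem twist_map_left_comp_fst {X Y : SchemeOver L} (f : X ⟶ Y) :
    ((twist L τ).map f).left ≫ pullback.fst Y.hom (specAut L τ) =
      pullback.fst X.hom (specAut L τ) ≫ f.left :=
  pullback.lift_fst _ _ _

/-- The unit `ε : Spec L → (Spec L)^τ` of the monoidal twist functor, followed by `pr₁`, is
`Spec τ`. [folklore] -/
private theorem ε_left_comp_fst :
    (Functor.LaxMonoidal.ε (twist L τ)).left ≫ pullback.fst (𝟙_ (SchemeOver L)).hom (specAut L τ) =
      specAut L τ := by
  have h1 : pullback.fst (𝟙_ (SchemeOver L)).hom (specAut L τ) =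
      pullback.snd (𝟙_ (SchemeOver L)).hom (specAut L τ) ≫ specAut L τ := by
    have h := pullback.condition (f := (𝟙_ (SchemeOver L)).hom) (g := specAut L τ)
    exact (Category.comp_id _).symm.trans h
  have h2 : (Functor.LaxMonoidal.ε (twist L τ)).left ≫
      pullback.snd (𝟙_ (SchemeOver L)).hom (specAut L τ) = 𝟙 _ :=
    Over.w (Functor.LaxMonoidal.ε (twist L τ))
  rw [h1, ← Category.assoc, h2, Category.id_comp]

variable (A : AbelianVariety L)

/-- **The conjugate abelian variety `A^τ = A ×_{Spec L, Spec τ} Spec L`**: the image of the group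
`L`-scheme `A` under the monoidal twist functor `twist L τ = Over.pullback (Spec τ)` (Mathlib
`Functor.grpObjObj`); proper and geometrically integral as a base change (private plumbing).
[folklore] -/
private abbrev twistAV : AbelianVariety L where
  X := (twist L τ).obj A.X
  grpObj := Functor.grpObjObj (F := twist L τ) (G := A.X)
  isProper := by
    change IsProper (pullback.snd A.X.hom (specAut L τ))
    infer_instance
  geometricallyIntegral := by
    change GeometricallyIntegral (pullback.snd A.X.hom (specAut L τ))
    infer_instance

/-- The unit of `A^τ` followed by `pr₁ : A^τ → A` is `Spec τ ≫ e_A`. [folklore] -/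
private theorem one_twist_left_comp_fst :
    (η[(twistAV L τ A).X]).left ≫ pullback.fst A.X.hom (specAut L τ) =
      specAut L τ ≫ (η[A.X]).left := by
  change (Functor.LaxMonoidal.ε (twist L τ) ≫ (twist L τ).map η[A.X]).left ≫
    pullback.fst A.X.hom (specAut L τ) = _
  rw [Over.comp_left, Category.assoc, twist_map_left_comp_fst, ← Category.assoc, ε_left_comp_fst]

/-- The inversion of `A^τ` over `pr₁` is the inversion of `A`. [folklore] -/
private theorem inv_twist_left_comp_fst :
    (ι[(twistAV L τ A).X]).left ≫ pullback.fst A.X.hom (specAut L τ) =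
      pullback.fst A.X.hom (specAut L τ) ≫ (ι[A.X]).left := by
  change ((twist L τ).map ι[A.X]).left ≫ pullback.fst A.X.hom (specAut L τ) = _
  exact twist_map_left_comp_fst L τ _

/-- `(T → Spec L → A^τ) ≫ pr₁ = (T → Spec L) ≫ Spec τ ≫ e_A` for the constant morphism at the
unit. [folklore] -/
private theorem one_hom_twist_left_comp_fst (T : SchemeOver L) :
    (toUnit T ≫ η[(twistAV L τ A).X]).left ≫ pullback.fst A.X.hom (specAut L τ) =
      T.hom ≫ specAut L τ ≫ (η[A.X]).left := by
  have hT : (toUnit T).left = T.hom := (Category.comp_id _).symm.trans (Over.w (toUnit T))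
  rw [Over.comp_left, Category.assoc, one_twist_left_comp_fst, hT]

variable {A}

/-- The `τ`-semilinear endomorphism `ρ_u = u ≫ pr₁` of the scheme `A` underlying a homomorphism
`u : A → A^τ` (private plumbing). [folklore] -/
private def descLeft (u : A ⟶ twistAV L τ A) : A.X.left ⟶ A.X.left :=
  u.hom.hom.hom.left ≫ pullback.fst A.X.hom (specAut L τ)

/-- `ρ_u` covers `Spec τ`. [folklore] -/
private theorem descLeft_comp_hom (u : A ⟶ twistAV L τ A) :
    descLeft L τ u ≫ A.X.hom = A.X.hom ≫ specAut L τ := by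
  unfold descLeft
  rw [Category.assoc, pullback.condition, ← Category.assoc]
  congr 1
  exact Over.w u.hom.hom.hom

/-- `ρ_u` carries the unit to its `τ`-conjugate: `e ≫ ρ_u = Spec τ ≫ e`. [folklore] -/
private theorem one_left_comp_descLeft (u : A ⟶ twistAV L τ A) :
    (η[A.X]).left ≫ descLeft L τ u = specAut L τ ≫ (η[A.X]).left := by
  have h := congrArg (fun g => g.left ≫ pullback.fst A.X.hom (specAut L τ))
    (IsMonHom.one_hom u.hom.hom.hom)
  dsimp only at h
  rw [Over.comp_left, Category.assoc] at h
  exact h.trans (one_twist_left_comp_fst L τ A)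

/-- `ρ_u` commutes with the inversion. [folklore] -/
private theorem inv_left_comp_descLeft (u : A ⟶ twistAV L τ A) :
    (ι[A.X]).left ≫ descLeft L τ u = descLeft L τ u ≫ (ι[A.X]).left := by
  have h := congrArg (fun g => g.left ≫ pullback.fst A.X.hom (specAut L τ))
    (GrpObj.inv_hom u.hom.hom.hom)
  dsimp only at h
  rw [Over.comp_left, Category.assoc, Over.comp_left, Category.assoc] at h
  unfold descLeft
  rw [Category.assoc]
  exact h.trans (congrArg (u.hom.hom.hom.left ≫ ·) (inv_twist_left_comp_fst L τ A))

/-- `ρ_u` is compatible with the multiplication: `(ρ_u × ρ_u) ≫ m = m ≫ ρ_u`. [folklore] -/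
private theorem map_comp_mul_left_descLeft (u : A ⟶ twistAV L τ A) :
    pullback.map A.X.hom A.X.hom A.X.hom A.X.hom (descLeft L τ u) (descLeft L τ u) (specAut L τ)
        (descLeft_comp_hom L τ u).symm (descLeft_comp_hom L τ u).symm ≫ (μ[A.X]).left =
      (μ[A.X]).left ≫ descLeft L τ u := by
  have hP1 : pullback.map A.X.hom A.X.hom A.X.hom A.X.hom (descLeft L τ u) (descLeft L τ u)
      (specAut L τ) (descLeft_comp_hom L τ u).symm (descLeft_comp_hom L τ u).symm ≫
        pullback.fst A.X.hom A.X.hom = pullback.fst A.X.hom A.X.hom ≫ descLeft L τ u :=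
    pullback.lift_fst _ _ _
  have hP2 : pullback.map A.X.hom A.X.hom A.X.hom A.X.hom (descLeft L τ u) (descLeft L τ u)
      (specAut L τ) (descLeft_comp_hom L τ u).symm (descLeft_comp_hom L τ u).symm ≫
        pullback.snd A.X.hom A.X.hom = pullback.snd A.X.hom A.X.hom ≫ descLeft L τ u :=
    pullback.lift_snd _ _ _
  have e1 : ((u.hom.hom.hom ⊗ₘ u.hom.hom.hom) ≫ Functor.LaxMonoidal.μ (twist L τ) A.X A.X) ≫
      (twist L τ).map (fst A.X A.X) = fst A.X A.X ≫ u.hom.hom.hom := by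
    rw [Category.assoc, Functor.Monoidal.μ_fst, tensorHom_fst]
  have e2 : ((u.hom.hom.hom ⊗ₘ u.hom.hom.hom) ≫ Functor.LaxMonoidal.μ (twist L τ) A.X A.X) ≫
      (twist L τ).map (snd A.X A.X) = snd A.X A.X ≫ u.hom.hom.hom := by
    rw [Category.assoc, Functor.Monoidal.μ_snd, tensorHom_snd]
  have e3 : ((u.hom.hom.hom ⊗ₘ u.hom.hom.hom) ≫ Functor.LaxMonoidal.μ (twist L τ) A.X A.X) ≫
      (twist L τ).map μ[A.X] = μ[A.X] ≫ u.hom.hom.hom := by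
    rw [Category.assoc]
    exact (IsMonHom.mul_hom u.hom.hom.hom).symm
  have f1 : pullback.fst (A.X ⊗ A.X).hom (specAut L τ) ≫ pullback.fst A.X.hom A.X.hom =
      ((twist L τ).map (fst A.X A.X)).left ≫ pullback.fst A.X.hom (specAut L τ) := by
    rw [← Over.fst_left]; exact (twist_map_left_comp_fst L τ (fst A.X A.X)).symm
  have f2 : pullback.fst (A.X ⊗ A.X).hom (specAut L τ) ≫ pullback.snd A.X.hom A.X.hom =
      ((twist L τ).map (snd A.X A.X)).left ≫ pullback.fst A.X.hom (specAut L τ) := by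
    rw [← Over.snd_left]; exact (twist_map_left_comp_fst L τ (snd A.X A.X)).symm
  have f3 : pullback.fst (A.X ⊗ A.X).hom (specAut L τ) ≫ (μ[A.X]).left =
      ((twist L τ).map μ[A.X]).left ≫ pullback.fst A.X.hom (specAut L τ) :=
    (twist_map_left_comp_fst L τ μ[A.X]).symm
  have key : ((u.hom.hom.hom ⊗ₘ u.hom.hom.hom) ≫ Functor.LaxMonoidal.μ (twist L τ) A.X A.X).left ≫
        pullback.fst (A.X ⊗ A.X).hom (specAut L τ) =
      pullback.map A.X.hom A.X.hom A.X.hom A.X.hom (descLeft L τ u) (descLeft L τ u) (specAut L τ)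
        (descLeft_comp_hom L τ u).symm (descLeft_comp_hom L τ u).symm := by
    unfold descLeft at hP1 hP2 ⊢
    apply Over.tensorObj_ext
    · rw [hP1, Category.assoc, f1, ← Over.comp_left_assoc, e1, Over.comp_left, Category.assoc,
        Over.fst_left]
    · rw [hP2, Category.assoc, f2, ← Over.comp_left_assoc, e2, Over.comp_left, Category.assoc,
        Over.snd_left]
  rw [← key, Category.assoc, f3, ← Over.comp_left_assoc, e3, Over.comp_left, Category.assoc]
  rfl

/-- The `L`-morphism `(s, p) : A → A^τ = A ×_{Spec L, Spec τ} Spec L` defined by a `τ`-semilinear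
`s : A → A` (private plumbing). [folklore] -/
private def twistLift (s : A.X.left ⟶ A.X.left) (hs : s ≫ A.X.hom = A.X.hom ≫ specAut L τ) :
    A.X ⟶ (twistAV L τ A).X :=
  Over.homMk (pullback.lift s A.X.hom hs) (by exact pullback.lift_snd _ _ _)

/-- `(s, p) ≫ pr₁ = s`. [folklore] -/
private theorem twistLift_left_comp_fst (s : A.X.left ⟶ A.X.left)
    (hs : s ≫ A.X.hom = A.X.hom ≫ specAut L τ) :
    (twistLift L τ s hs).left ≫ pullback.fst A.X.hom (specAut L τ) = s :=
  pullback.lift_fst _ _ _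

/-- **A `τ`-semilinear unit-preserving morphism `s : A → A` is `ρ_u` for a homomorphism
`u : A → A^τ`** (`u = (s, p)`, a homomorphism by rigidity, `AbelianVariety.homOfOneComp`, Milne AV
Cor. 2.2). [cite: Milne1986AbelianVarieties, §2 Cor. 2.2] -/
private def twistHom (s : A.X.left ⟶ A.X.left) (hs : s ≫ A.X.hom = A.X.hom ≫ specAut L τ)
    (hone : (η[A.X]).left ≫ s = specAut L τ ≫ (η[A.X]).left) : A ⟶ twistAV L τ A :=
  AbelianVariety.homOfOneComp (twistLift L τ s hs) (by
    ext1
    apply pullback.hom_ext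
    · refine Eq.trans ?_ (one_twist_left_comp_fst L τ A).symm
      rw [Over.comp_left, Category.assoc, twistLift_left_comp_fst, hone]
    · exact (Over.w _).trans (Over.w _).symm)

/-- `ρ_{u_s} = s`. [folklore] -/
private theorem descLeft_twistHom (s : A.X.left ⟶ A.X.left) (hs : s ≫ A.X.hom = A.X.hom ≫ specAut L τ)
    (hone : (η[A.X]).left ≫ s = specAut L τ ≫ (η[A.X]).left) :
    descLeft L τ (twistHom L τ s hs hone) = s :=
  twistLift_left_comp_fst L τ s hs

end Twist

/-! ### The Galois action on a Jacobian of `C_L` -/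

section Action

variable {k : Type u} [Field k] (L : Type u) [Field L] [Algebra k L] {C : SchemeOver k}
  (𝒥 : Jacobian ((bcFunctor k L).obj C))

/-- The product Galois automorphism `σ × σ` of `C_L ×_L C_L` (over `Spec σ⁻¹`). [folklore] -/
private def galCC (σ : L ≃ₐ[k] L) :
    ((bcFunctor k L).obj C ⊗ (bcFunctor k L).obj C).left ⟶
      ((bcFunctor k L).obj C ⊗ (bcFunctor k L).obj C).left :=
  pullback.map _ _ _ _ (GaloisDescent.gal L C σ) (GaloisDescent.gal L C σ) (specAut L σ⁻¹)
    (GaloisDescent.gal_snd L C σ).symm (GaloisDescent.gal_snd L C σ).symm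

/-- `(σ × σ) ≫ pr₁ = pr₁ ≫ σ`. [folklore] -/
@[reassoc]
private theorem galCC_fst (σ : L ≃ₐ[k] L) :
    galCC L σ ≫ (fst ((bcFunctor k L).obj C) ((bcFunctor k L).obj C)).left =
      (fst ((bcFunctor k L).obj C) ((bcFunctor k L).obj C)).left ≫ GaloisDescent.gal L C σ := by
  rw [Over.fst_left]; exact pullback.lift_fst _ _ _

/-- `(σ × σ) ≫ pr₂ = pr₂ ≫ σ`. [folklore] -/
@[reassoc]
private theorem galCC_snd (σ : L ≃ₐ[k] L) :
    galCC L σ ≫ (snd ((bcFunctor k L).obj C) ((bcFunctor k L).obj C)).left =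
      (snd ((bcFunctor k L).obj C) ((bcFunctor k L).obj C)).left ≫ GaloisDescent.gal L C σ := by
  rw [Over.snd_left]; exact pullback.lift_snd _ _ _

/-- `σ × σ` covers `Spec σ⁻¹`. [folklore] -/
private theorem galCC_comp_hom (σ : L ≃ₐ[k] L) :
    galCC L σ ≫ ((bcFunctor k L).obj C ⊗ (bcFunctor k L).obj C).hom =
      ((bcFunctor k L).obj C ⊗ (bcFunctor k L).obj C).hom ≫ specAut L σ⁻¹ := by
  rw [Over.tensorObj_hom, ← Over.fst_left, galCC_fst_assoc, Category.assoc]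
  congr 1
  exact GaloisDescent.gal_snd L C σ

/-- `1 × 1 = 1`. [folklore] -/
private theorem galCC_one : galCC (C := C) L (1 : L ≃ₐ[k] L) = 𝟙 _ := by
  apply Over.tensorObj_ext
  · rw [← Over.fst_left, galCC_fst, GaloisDescent.gal_one]
    exact (Category.comp_id _).trans (Category.id_comp _).symm
  · rw [← Over.snd_left, galCC_snd, GaloisDescent.gal_one]
    exact (Category.comp_id _).trans (Category.id_comp _).symm

/-- `(στ × στ) = (τ × τ) ≫ (σ × σ)`. [folklore] -/
private theorem galCC_mul (σ τ : L ≃ₐ[k] L) :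
    galCC (C := C) L (σ * τ) = galCC L τ ≫ galCC L σ := by
  apply Over.tensorObj_ext
  · rw [← Over.fst_left, galCC_fst, Category.assoc, galCC_fst, galCC_fst_assoc,
      GaloisDescent.gal_mul]
  · rw [← Over.snd_left, galCC_snd, Category.assoc, galCC_snd, galCC_snd_assoc,
      GaloisDescent.gal_mul]

/-- The diagonal is Galois-equivariant: `Δ ≫ (σ × σ) = σ ≫ Δ`. [folklore] -/
private theorem diag_left_comp_galCC (σ : L ≃ₐ[k] L) :
    (lift (𝟙 ((bcFunctor k L).obj C)) (𝟙 ((bcFunctor k L).obj C))).left ≫ galCC L σ =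
      GaloisDescent.gal L C σ ≫
        (lift (𝟙 ((bcFunctor k L).obj C)) (𝟙 ((bcFunctor k L).obj C))).left := by
  apply Over.tensorObj_ext
  · rw [Category.assoc, Category.assoc, ← Over.fst_left, galCC_fst, ← Over.comp_left_assoc, lift_fst,
      ← Over.comp_left, lift_fst, Over.id_left]
    exact (Category.id_comp _).trans (Category.comp_id _).symm
  · rw [Category.assoc, Category.assoc, ← Over.snd_left, galCC_snd, ← Over.comp_left_assoc, lift_snd,
      ← Over.comp_left, lift_snd, Over.id_left]
    exact (Category.id_comp _).trans (Category.comp_id _).symm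

/-- The Galois automorphism of `(C × C)_L` is carried to `σ × σ` by the monoidal structure
isomorphism `δ : (C × C)_L ⥲ C_L × C_L`. [folklore] -/
@[reassoc]
private theorem gal_comp_δ_left (σ : L ≃ₐ[k] L) :
    GaloisDescent.gal L (C ⊗ C) σ ≫ (Functor.OplaxMonoidal.δ (bcFunctor k L) C C).left =
      (Functor.OplaxMonoidal.δ (bcFunctor k L) C C).left ≫ galCC L σ := by
  apply Over.tensorObj_ext
  · rw [Category.assoc, Category.assoc, ← Over.fst_left, galCC_fst, ← Over.comp_left,
      Functor.OplaxMonoidal.δ_fst, ← Over.comp_left_assoc, Functor.OplaxMonoidal.δ_fst,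
      GaloisDescent.gal_comp_map_left]
  · rw [Category.assoc, Category.assoc, ← Over.snd_left, galCC_snd, ← Over.comp_left,
      Functor.OplaxMonoidal.δ_snd, ← Over.comp_left_assoc, Functor.OplaxMonoidal.δ_snd,
      GaloisDescent.gal_comp_map_left]

/-- `μ ≫ gal σ = (σ × σ) ≫ μ` for the lax structure isomorphism `μ : C_L × C_L ⥲ (C × C)_L`.
[folklore] -/
@[reassoc]
private theorem μ_left_comp_gal (σ : L ≃ₐ[k] L) :
    (Functor.LaxMonoidal.μ (bcFunctor k L) C C).left ≫ GaloisDescent.gal L (C ⊗ C) σ =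
      galCC L σ ≫ (Functor.LaxMonoidal.μ (bcFunctor k L) C C).left := by
  have h : (Functor.OplaxMonoidal.δ (bcFunctor k L) C C).left ≫
      (Functor.LaxMonoidal.μ (bcFunctor k L) C C).left = 𝟙 (GaloisDescent.bc L (C ⊗ C)) := by
    rw [← Over.comp_left, Functor.Monoidal.δ_μ]
    exact Over.id_left _
  rw [← Category.comp_id (GaloisDescent.gal L (C ⊗ C) σ), ← h, gal_comp_δ_left_assoc,
    ← Over.comp_left_assoc, Functor.Monoidal.μ_δ, Over.id_left, Category.id_comp]

/-- **The twisted difference map `F' ∘ (σ × σ) : C_L × C_L → J'^{σ⁻¹}`**, an `L`-morphism into the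
conjugate abelian variety (Milne §6: "`σF`"). [cite: Milne1986JacobianVarieties, §6 Prop. 6.4 (proof)] -/
private def diffTwist (σ : L ≃ₐ[k] L) :
    (bcFunctor k L).obj C ⊗ (bcFunctor k L).obj C ⟶ (twistAV L σ⁻¹ 𝒥.J).X :=
  Over.homMk (pullback.lift (galCC L σ ≫ 𝒥.diff.left)
    ((bcFunctor k L).obj C ⊗ (bcFunctor k L).obj C).hom (by
      rw [Category.assoc, Over.w 𝒥.diff]; exact galCC_comp_hom L σ))
    (by exact pullback.lift_snd _ _ _)

/-- `(F' ∘ (σ × σ)) ≫ pr₁ = (σ × σ) ≫ F'`. [folklore] -/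
private theorem diffTwist_left_comp_fst (σ : L ≃ₐ[k] L) :
    (diffTwist L 𝒥 σ).left ≫ pullback.fst 𝒥.J.X.hom (specAut L σ⁻¹) = galCC L σ ≫ 𝒥.diff.left :=
  pullback.lift_fst _ _ _

/-- `(1 : T → B).left = T.hom ≫ e_B.left` for the constant morphism `1`. [folklore] -/
private theorem one_left {K' : Type u} [Field K'] (T : SchemeOver K') (B : AbelianVariety K') :
    (1 : T ⟶ B.X).left = T.hom ≫ (η[B.X]).left := by
  have hT : (toUnit T).left = T.hom := (Category.comp_id _).symm.trans (Over.w (toUnit T))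
  rw [Hom.one_def, Over.comp_left, hT]

/-- The twisted difference map is trivial on the diagonal (the right-hand side is the constant
morphism `1 = toUnit ≫ e`, `Hom.one_def`). [folklore] -/
private theorem diag_diffTwist (σ : L ≃ₐ[k] L) :
    lift (𝟙 ((bcFunctor k L).obj C)) (𝟙 ((bcFunctor k L).obj C)) ≫ diffTwist L 𝒥 σ =
      toUnit _ ≫ η[(twistAV L σ⁻¹ 𝒥.J).X] := by
  ext1
  apply pullback.hom_ext
  · rw [Over.comp_left, Category.assoc, diffTwist_left_comp_fst, reassoc_of% (diag_left_comp_galCC L σ),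
      ← Over.comp_left, 𝒥.diag_diff, one_left, one_hom_twist_left_comp_fst]
    exact GaloisDescent.gal_snd_assoc L C σ _
  · exact (Over.w _).trans (Over.w _).symm

/-- **The homomorphism `u_σ : J' → J'^{σ⁻¹}`** through which `F' ∘ (σ × σ)` factors (universal
property of the Jacobian of `C_L`). [cite: Milne1986JacobianVarieties, §6 Prop. 6.4 (proof) and Remark 6.5] -/
private def descTwist (σ : L ≃ₐ[k] L) : 𝒥.J ⟶ twistAV L σ⁻¹ 𝒥.J :=
  𝒥.desc (diffTwist L 𝒥 σ) (diag_diffTwist L 𝒥 σ)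

/-- **The Galois automorphism `ρ σ = u_σ ≫ pr₁` of the scheme `J'`** (`σ⁻¹`-semilinear).
[cite: Milne1986JacobianVarieties, Remark 1.9 and §6 Prop. 6.4 (proof)] -/
private def galJ (σ : L ≃ₐ[k] L) : 𝒥.J.X.left ⟶ 𝒥.J.X.left := descLeft L σ⁻¹ (descTwist L 𝒥 σ)

/-- **`F'` is equivariant: `F' ≫ ρ σ = (σ × σ) ≫ F'`.** [cite: Milne1986JacobianVarieties, §6 ("σF = F")] -/
private theorem diff_left_comp_galJ (σ : L ≃ₐ[k] L) :
    𝒥.diff.left ≫ galJ L 𝒥 σ = galCC L σ ≫ 𝒥.diff.left := by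
  unfold galJ descLeft
  rw [← Over.comp_left_assoc, descTwist, 𝒥.fac, diffTwist_left_comp_fst]

/-- `ρ σ` covers `Spec σ⁻¹`. [folklore] -/
private theorem galJ_comp_hom (σ : L ≃ₐ[k] L) :
    galJ L 𝒥 σ ≫ 𝒥.J.X.hom = 𝒥.J.X.hom ≫ specAut L σ⁻¹ :=
  descLeft_comp_hom L σ⁻¹ _

/-- `e ≫ ρ σ = Spec σ⁻¹ ≫ e`. [folklore] -/
private theorem one_left_comp_galJ (σ : L ≃ₐ[k] L) :
    (η[𝒥.J.X]).left ≫ galJ L 𝒥 σ = specAut L σ⁻¹ ≫ (η[𝒥.J.X]).left :=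
  one_left_comp_descLeft L σ⁻¹ _

/-- `i ≫ ρ σ = ρ σ ≫ i`. [folklore] -/
private theorem inv_left_comp_galJ (σ : L ≃ₐ[k] L) :
    (ι[𝒥.J.X]).left ≫ galJ L 𝒥 σ = galJ L 𝒥 σ ≫ (ι[𝒥.J.X]).left :=
  inv_left_comp_descLeft L σ⁻¹ _

/-- **Uniqueness**: a `σ⁻¹`-semilinear unit-preserving `s : J' → J'` with `F' ≫ s = (σ × σ) ≫ F'`
is `ρ σ` (uniqueness in the universal property). [cite: Milne1986JacobianVarieties, §6 Remark 6.5] -/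
private theorem eq_galJ (σ : L ≃ₐ[k] L) (s : 𝒥.J.X.left ⟶ 𝒥.J.X.left)
    (hs : s ≫ 𝒥.J.X.hom = 𝒥.J.X.hom ≫ specAut L σ⁻¹)
    (hone : (η[𝒥.J.X]).left ≫ s = specAut L σ⁻¹ ≫ (η[𝒥.J.X]).left)
    (hdiff : 𝒥.diff.left ≫ s = galCC L σ ≫ 𝒥.diff.left) : s = galJ L 𝒥 σ := by
  have hv : twistHom L σ⁻¹ s hs hone = descTwist L 𝒥 σ := by
    refine 𝒥.uniq _ _ _ ?_
    ext1
    apply pullback.hom_ext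
    · rw [Over.comp_left, Category.assoc, diffTwist_left_comp_fst, ← hdiff]
      congr 1
      exact descLeft_twistHom L σ⁻¹ s hs hone
    · exact (Over.w _).trans (Over.w _).symm
  rw [← descLeft_twistHom L σ⁻¹ s hs hone, hv]
  rfl

/-- `ρ 1 = 1`. [folklore] -/
private theorem galJ_one : galJ L 𝒥 1 = 𝟙 _ := by
  refine (eq_galJ L 𝒥 1 (𝟙 _) ?_ ?_ ?_).symm
  · rw [inv_one, specAut_one, Category.id_comp, Category.comp_id]
  · rw [inv_one, specAut_one, Category.id_comp, Category.comp_id]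
  · rw [galCC_one, Category.id_comp, Category.comp_id]

/-- `ρ (στ) = ρ τ ≫ ρ σ` (the cocycle condition). [cite: Milne1986JacobianVarieties, Remark 1.9] -/
private theorem galJ_mul (σ τ : L ≃ₐ[k] L) : galJ L 𝒥 (σ * τ) = galJ L 𝒥 τ ≫ galJ L 𝒥 σ := by
  refine (eq_galJ L 𝒥 (σ * τ) (galJ L 𝒥 τ ≫ galJ L 𝒥 σ) ?_ ?_ ?_).symm
  · rw [Category.assoc, galJ_comp_hom, reassoc_of% (galJ_comp_hom L 𝒥 τ), mul_inv_rev, specAut_mul]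
  · rw [reassoc_of% (one_left_comp_galJ L 𝒥 τ), one_left_comp_galJ, mul_inv_rev, specAut_mul,
      Category.assoc]
  · rw [reassoc_of% (diff_left_comp_galJ L 𝒥 τ), diff_left_comp_galJ, galCC_mul, Category.assoc]

/-- `ρ σ ≫ ρ σ⁻¹ = 1`. [folklore] -/
private theorem galJ_comp_galJ_symm (σ : L ≃ₐ[k] L) : galJ L 𝒥 σ ≫ galJ L 𝒥 σ⁻¹ = 𝟙 _ := by
  rw [← galJ_mul, inv_mul_cancel, galJ_one]

/-- **The Galois action on the scheme `J'` over `Spec k`.** [cite: Milne1986JacobianVarieties, Remark 1.9] -/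
private def galAction : RelativeSpec.ActionOver (𝒥.J.X.hom ≫ bcSpec k L) (L ≃ₐ[k] L) where
  aut :=
    { toFun := fun σ => ⟨galJ L 𝒥 σ, galJ L 𝒥 σ⁻¹, galJ_comp_galJ_symm L 𝒥 σ, by
        simpa only [inv_inv] using galJ_comp_galJ_symm L 𝒥 σ⁻¹⟩
      map_one' := by ext1; exact galJ_one L 𝒥
      map_mul' := fun σ τ => by ext1; exact galJ_mul L 𝒥 σ τ }
  aut_comp σ := by
    change galJ L 𝒥 σ ≫ 𝒥.J.X.hom ≫ bcSpec k L = _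
    rw [reassoc_of% (galJ_comp_hom L 𝒥 σ), specAut_comp_bcSpec]

end Action

variable {k : Type u} [Field k] {C : SchemeOver k} {n : ℕ}

/-- **Galois descent of an abstract Jacobian** (Milne, *Jacobian Varieties*, Remark 1.9 with §6,
proof of Prop. 6.4): a smooth projective geometrically irreducible `C / k`, of any dimension, has a
Jacobian over `k` as soon as its base change `C_L` to some finite Galois extension `L / k` has one.
Proof: the Galois action `galAction` on `J(C_L)` built from the universal property is semilinear and
compatible with the group law, so `J(C_L) ≅ J_L` for an abelian variety `J / k`
(`GaloisDescentAbelianVariety.exists_iso_baseChange`), equivariantly; the difference map is then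
Galois-equivariant and descends (`Jacobian.nonempty_of_galoisDescent`).
[cite: Milne1986JacobianVarieties, Remark 1.9 and §6 Prop. 6.4 (proof, first paragraph)]
[cite: GortzWedhorn2020, Thm. 14.83 and Cor. 14.85] -/
theorem nonempty_of_jacobian_baseChange (hC : IsSmoothProjective n C) (L : Type u) [Field L]
    [Algebra k L] [FiniteDimensional k L] [IsGalois k L]
    (𝒥 : Jacobian ((bcFunctor k L).obj C)) : Nonempty (Jacobian C) := by
  have hρ : ∀ σ : L ≃ₐ[k] L,
      ((galAction L 𝒥).aut σ).hom ≫ 𝒥.J.X.hom = 𝒥.J.X.hom ≫ specAut L σ⁻¹ :=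
    fun σ => galJ_comp_hom L 𝒥 σ
  obtain ⟨J, e, he⟩ := GaloisDescentAbelianVariety.exists_iso_baseChange L 𝒥.J (galAction L 𝒥) hρ
    (fun σ => map_comp_mul_left_descLeft L σ⁻¹ (descTwist L 𝒥 σ))
    (fun σ => one_left_comp_galJ L 𝒥 σ) (fun σ => inv_left_comp_galJ L 𝒥 σ)
  refine nonempty_of_galoisDescent hC L J 𝒥 e (fun σ => ?_)
  haveI : IsIso (Functor.LaxMonoidal.μ (bcFunctor k L) C C).left :=
    ((Over.forget _).mapIso (Functor.Monoidal.μIso (bcFunctor k L) C C)).isIso_hom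
  rw [← cancel_epi (Functor.LaxMonoidal.μ (bcFunctor k L) C C).left, μ_left_comp_gal_assoc,
    ← Over.comp_left, ← Over.comp_left_assoc, μ_comp_diffBaseChange, Over.comp_left,
    Category.assoc, ← reassoc_of% (diff_left_comp_galJ L 𝒥 σ)]
  congr 1
  exact he σ

end Jacobian

/-! ### The named fact `jacobian_galoisDescent`, proved -/

/-- **Galois descent of the Jacobian of a smooth projective curve** — the named fact
`jacobian_galoisDescent` of `Motives/JacobianExistenceSplit` (Milne, *Jacobian Varieties*,
Remark 1.9 and §6, proof of Prop. 6.4, first paragraph) is a THEOREM: case `n = 1` of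
`Jacobian.nonempty_of_jacobian_baseChange`.
[cite: Milne1986JacobianVarieties, Remark 1.9 and §6 Prop. 6.4 (proof, first paragraph)] -/
theorem jacobian_galoisDescent_holds : jacobian_galoisDescent.{u} := by
  intro k _ C hC L _ _ _ _ h
  obtain ⟨𝒥⟩ := h
  exact Jacobian.nonempty_of_jacobian_baseChange hC L 𝒥

/-- **Existence of the Jacobian from the pointed case alone**: `nonempty_jacobian_of_isSmoothProjective`
(every smooth projective curve has a Jacobian, Milne Thm. 1.1 + Prop. 6.4) follows from the named fact
`nonempty_jacobian_of_algPoints` (the case with a rational point), the Galois descent being proved.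
[cite: Milne1986JacobianVarieties, §6 Prop. 6.4 (proof) with Thm. 1.1] -/
theorem nonempty_jacobian_of_isSmoothProjective_of_algPoints_fact
    (hA : nonempty_jacobian_of_algPoints.{u}) : nonempty_jacobian_of_isSmoothProjective.{u} :=
  nonempty_jacobian_of_isSmoothProjective_holds_of hA jacobian_galoisDescent_holds

/-! ### The descended Jacobian remembers its base change (appended 2026-08-28, cell `hodgecm-mathlib`,
III-0 road F0: the comparison isomorphism is needed to read `dim J(C_L) = dim J(C)` off the descent) -/

namespace Jacobian

open AbelianVariety (bcSpec bcFunctor specAut)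
open scoped MonObj Obj

set_option backward.isDefEq.respectTransparency false

variable {k : Type u} [Field k] {C : SchemeOver k} {n : ℕ}

/-- **Galois descent of an abstract Jacobian, WITH the comparison isomorphism.** For `C / k` smooth
projective geometrically irreducible (any dimension), a finite Galois `L / k` and a Jacobian `𝒥` of
`C_L`, there is a Jacobian `𝒥₀` of `C` over `k` whose abelian variety base-changes to that of `𝒥`:
`𝒥.J ≅ 𝒥₀.J ×_k L`. Same proof as `nonempty_of_jacobian_baseChange` (Milne, *Jacobian Varieties*,
Remark 1.9 with §6, proof of Prop. 6.4: the semilinear Galois action on `J(C_L)` from the universal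
property descends `J(C_L)` to `J / k`, `GaloisDescentAbelianVariety.exists_iso_baseChange`, and the
equivariant difference map descends, `ofGaloisDescentOfSmoothProjective`), keeping the isomorphism `e`
that `exists_iso_baseChange` returns (`ofGaloisDescentOfEquivariant_J`: the descended Jacobian's variety
is `J` by `rfl`). [cite: Milne1986JacobianVarieties, Remark 1.9 and §6 Prop. 6.4 (proof, first paragraph)]
[cite: GortzWedhorn2020, Thm. 14.83 and Cor. 14.85] -/
theorem exists_jacobian_nonempty_iso_baseChange (hC : IsSmoothProjective n C) (L : Type u) [Field L]
    [Algebra k L] [FiniteDimensional k L] [IsGalois k L]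
    (𝒥 : Jacobian ((bcFunctor k L).obj C)) :
    ∃ 𝒥₀ : Jacobian C, Nonempty (𝒥.J ≅ 𝒥₀.J.baseChange L) := by
  have hρ : ∀ σ : L ≃ₐ[k] L,
      ((galAction L 𝒥).aut σ).hom ≫ 𝒥.J.X.hom = 𝒥.J.X.hom ≫ specAut L σ⁻¹ :=
    fun σ => galJ_comp_hom L 𝒥 σ
  obtain ⟨J, e, he⟩ := GaloisDescentAbelianVariety.exists_iso_baseChange L 𝒥.J (galAction L 𝒥) hρ
    (fun σ => map_comp_mul_left_descLeft L σ⁻¹ (descTwist L 𝒥 σ))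
    (fun σ => one_left_comp_galJ L 𝒥 σ) (fun σ => inv_left_comp_galJ L 𝒥 σ)
  have hσ : ∀ σ : L ≃ₐ[k] L, GaloisDescent.gal L (C ⊗ C) σ ≫ (diffBaseChange L 𝒥 e).left =
      (diffBaseChange L 𝒥 e).left ≫ J.gal L σ := fun σ => by
    haveI : IsIso (Functor.LaxMonoidal.μ (bcFunctor k L) C C).left :=
      ((Over.forget _).mapIso (Functor.Monoidal.μIso (bcFunctor k L) C C)).isIso_hom
    rw [← cancel_epi (Functor.LaxMonoidal.μ (bcFunctor k L) C C).left, μ_left_comp_gal_assoc,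
      ← Over.comp_left, ← Over.comp_left_assoc, μ_comp_diffBaseChange, Over.comp_left,
      Category.assoc, ← reassoc_of% (diff_left_comp_galJ L 𝒥 σ)]
    congr 1
    exact he σ
  exact ⟨ofGaloisDescentOfSmoothProjective L hC 𝒥 e hσ, ⟨e⟩⟩

end Jacobian

end Literature.AlgebraicGeometry.Motives

end
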